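import Literature.Topology.FourManifolds.CompactlySupportedDiffeo
import Mathlib.Analysis.SpecialFunctions.SmoothTransition
import Mathlib.Analysis.Calculus.BumpFunction.FiniteDimension
import HarnessLib

/-!
# A radial diffeomorphism interpolating between two disc inversions

Topic `Literature/Topology/FourManifolds` (brick [B2a] of the discharge of
`Literature.Topology.FourManifolds.nonempty_diffeomorph_of_isOrientedConnectedSum` at arbitrary
models, see `ConnectedSumUniquenessProofs.lean`; pure normed-space analysis).

Kervaire–Milnor's connected sum glues the punctured unit discs along the inversion
`σ v = (‖v‖⁻¹ - 1) v` of the model space `E` (*Groups of homotopy spheres I* (1963), §2). When the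
discs are reparametrised by a linear automorphism `T` of `E` which is *not* an isometry of the
norm (as happens when the orientation convention of the model disc is reversed by a reflection
and `E` is an arbitrary finite-dimensional normed space), the gluing map becomes the inversion
`σ_T v = (‖T v‖⁻¹ - 1) v` of the `T`-disc `{‖T v‖ < 1}`. Comparing the two gluings
(`ConnectedSumShape.lean`) requires a diffeomorphism `β` of `E` which equals `σ_T ∘ σ` on a shell
`{ρ₂ < ‖v‖ ≤ 1}` and the identity far out. This file constructs `β`
(`Literature.Topology.FourManifolds.ShapeRadial.exists_shapeDiffeo`), assuming the norm of `E`
is smooth away from `0` and `‖v‖ ≤ ‖T v‖`: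

* on the shell, `σ_T (σ v)` is the *radial shift* `v ↦ ((‖v‖ + c v) / ‖v‖) v` by the
  non-positive, `0`-homogeneous amount `c v = ‖v‖ / ‖T v‖ - 1` (`ShapeRadial.shift`);
* `β` is the `K`-fold iterate of the small radial perturbation
  `v ↦ v + K⁻¹ (c v · χ ‖v‖ · χ₀ ‖v‖ / ‖v‖) v` of the identity (`χ`, `χ₀` cut-offs built from
  `Real.smoothTransition`), which for `K` large is a diffeomorphism by the tree's quantitative
  inverse function theorem `Diffeomorph.ofNormFDerivSubIdLe` (`CompactlySupportedDiffeo.lean`;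
  the derivative of the compactly supported perturbation is bounded); iterating `K` times adds
  up to the full shift on the shell, where the cut-offs are `≡ 1` along the whole trajectory.

The recorded properties of `β` (fixing `0`, identity off `B(0, 2)`, the shell formula, radiality,
and two inequalities locating the images of the small ball and of the exterior of the unit ball)
are exactly what the comparison of gluings consumes. Everything is proved; no named facts.

## References

* M. Kervaire, J. Milnor, *Groups of homotopy spheres I*, Ann. of Math. 77 (1963), §2.
  [KervaireMilnorAnnals1963]
* M. W. Hirsch, *Differential Topology* (1976), Ch. 2 §1, Lemma 1.3 (small perturbations of the
  identity). [Hirsch1976]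
-/

open scoped Manifold ContDiff Topology
open Set Function Filter Metric

noncomputable section

namespace Literature.Topology.FourManifolds

namespace ShapeRadial

variable {E : Type*} [NormedAddCommGroup E] [NormedSpace ℝ E]

/-! ### Constants attached to `T` -/

/-- `Λ = max ‖T‖ 1`, a bound `‖T v‖ ≤ Λ ‖v‖` with `1 ≤ Λ`. [folklore] -/
def lam (T : E ≃L[ℝ] E) : ℝ := max ‖(T : E →L[ℝ] E)‖ 1

/-- `1 ≤ Λ`. [folklore] -/
theorem one_le_lam (T : E ≃L[ℝ] E) : 1 ≤ lam T := le_max_right _ _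

/-- `0 < Λ`. [folklore] -/
theorem lam_pos (T : E ≃L[ℝ] E) : 0 < lam T := one_pos.trans_le (one_le_lam T)

/-- `‖T v‖ ≤ Λ ‖v‖`. [folklore] -/
theorem norm_apply_le_lam (T : E ≃L[ℝ] E) (v : E) : ‖T v‖ ≤ lam T * ‖v‖ :=
  ((T : E →L[ℝ] E).le_opNorm v).trans (mul_le_mul_of_nonneg_right (le_max_left _ _) (norm_nonneg v))

/-- The inner radius `ρ₃ = 1 / (2 Λ)`. [folklore] -/
def rho₃ (T : E ≃L[ℝ] E) : ℝ := 1 / (2 * lam T)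

/-- The shell radius `ρ₂ = 1 - 1 / (2 Λ)`. [folklore] -/
def rho₂ (T : E ≃L[ℝ] E) : ℝ := 1 - rho₃ T

/-- `0 < ρ₃`. [folklore] -/
theorem rho₃_pos (T : E ≃L[ℝ] E) : 0 < rho₃ T := by
  unfold rho₃; have := lam_pos T; positivity

/-- `ρ₃ ≤ 1/2`. [folklore] -/
theorem rho₃_le_half (T : E ≃L[ℝ] E) : rho₃ T ≤ 1 / 2 := by
  unfold rho₃
  have h := one_le_lam T
  rw [div_le_div_iff₀ (by linarith) (by norm_num)]
  linarith

/-- `ρ₂ + ρ₃ = 1`. [folklore] -/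
theorem rho₂_add_rho₃ (T : E ≃L[ℝ] E) : rho₂ T + rho₃ T = 1 := by unfold rho₂; ring

/-- `1/2 ≤ ρ₂`. [folklore] -/
theorem half_le_rho₂ (T : E ≃L[ℝ] E) : 1 / 2 ≤ rho₂ T := by
  have := rho₃_le_half T; unfold rho₂; linarith

/-- `ρ₂ < 1`. [folklore] -/
theorem rho₂_lt_one (T : E ≃L[ℝ] E) : rho₂ T < 1 := by
  have := rho₃_pos T; unfold rho₂; linarith

/-- `0 < ρ₂`. [folklore] -/
theorem rho₂_pos (T : E ≃L[ℝ] E) : 0 < rho₂ T := by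
  have := half_le_rho₂ T; linarith

/-- `Λ ρ₃ = 1/2`. [folklore] -/
theorem lam_mul_rho₃ (T : E ≃L[ℝ] E) : lam T * rho₃ T = 1 / 2 := by
  unfold rho₃; have := lam_pos T; field_simp

/-! ### The radial shift `c v = ‖v‖ / ‖T v‖ - 1` -/

/-- The **radial shift** `c v = ‖v‖ / ‖T v‖ - 1` (the amount by which `σ_T ∘ σ` moves the sphere
of radius `‖v‖` in the direction of `v`); `0`-homogeneous. [folklore] -/
def shift (T : E ≃L[ℝ] E) (v : E) : ℝ := ‖v‖ / ‖T v‖ - 1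

/-- `-1 ≤ c v`. [folklore] -/
theorem neg_one_le_shift (T : E ≃L[ℝ] E) (v : E) : -1 ≤ shift T v := by
  unfold shift; have : 0 ≤ ‖v‖ / ‖T v‖ := by positivity
  linarith

/-- If `T` does not decrease norms then `c v ≤ 0`. [folklore] -/
theorem shift_nonpos {T : E ≃L[ℝ] E} (hT : ∀ v, ‖v‖ ≤ ‖T v‖) (v : E) : shift T v ≤ 0 := by
  unfold shift
  rcases eq_or_ne v 0 with rfl | hv
  · simp
  · have hTv : 0 < ‖T v‖ := norm_pos_iff.2 (by simpa using hv)
    rw [sub_nonpos, div_le_one hTv]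
    exact hT v

/-- `|c v| ≤ 1` when `T` does not decrease norms. [folklore] -/
theorem abs_shift_le_one {T : E ≃L[ℝ] E} (hT : ∀ v, ‖v‖ ≤ ‖T v‖) (v : E) : |shift T v| ≤ 1 := by
  rw [abs_le]; exact ⟨neg_one_le_shift T v, (shift_nonpos hT v).trans zero_le_one⟩

/-- `1 / Λ - 1 ≤ c v` for `v ≠ 0`. [folklore] -/
theorem inv_lam_sub_one_le_shift (T : E ≃L[ℝ] E) {v : E} (hv : v ≠ 0) :
    1 / lam T - 1 ≤ shift T v := by
  unfold shift
  have hTv : 0 < ‖T v‖ := norm_pos_iff.2 (by simpa using hv)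
  have h1 : 1 / lam T ≤ ‖v‖ / ‖T v‖ := by
    rw [div_le_div_iff₀ (lam_pos T) hTv, one_mul, mul_comm]
    exact norm_apply_le_lam T v
  linarith

/-- `ρ₂ + c v > 0` for `v ≠ 0` (indeed `≥ ρ₃ > 0`). [folklore] -/
theorem rho₃_le_rho₂_add_shift (T : E ≃L[ℝ] E) {v : E} (hv : v ≠ 0) :
    rho₃ T ≤ rho₂ T + shift T v := by
  have h1 := inv_lam_sub_one_le_shift T hv
  have h2 : rho₂ T = 1 - rho₃ T := rfl
  have h3 : 2 * rho₃ T = 1 / lam T := by unfold rho₃; ring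
  linarith

/-- The shift is `0`-homogeneous: `c (t • v) = c v` for `t ≠ 0`. [folklore] -/
theorem shift_smul (T : E ≃L[ℝ] E) {t : ℝ} (ht : t ≠ 0) (v : E) : shift T (t • v) = shift T v := by
  unfold shift
  rw [map_smul, norm_smul, norm_smul, mul_div_mul_left _ _ (by simpa using ht)]

/-- `1 + c v = ‖v‖ / ‖T v‖`. [folklore] -/
theorem one_add_shift (T : E ≃L[ℝ] E) (v : E) : 1 + shift T v = ‖v‖ / ‖T v‖ := by
  unfold shift; ring

/-! ### Cut-offs -/

/-- The outer cut-off `χ s = smoothTransition (2 - s)`: `1` for `s ≤ 1`, `0` for `s ≥ 2`.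
[folklore] -/
def cut (s : ℝ) : ℝ := Real.smoothTransition (2 - s)

/-- `χ s = 1` for `s ≤ 1`. [folklore] -/
theorem cut_of_le_one {s : ℝ} (hs : s ≤ 1) : cut s = 1 :=
  Real.smoothTransition.one_of_one_le (by linarith)

/-- `χ s = 0` for `2 ≤ s`. [folklore] -/
theorem cut_of_two_le {s : ℝ} (hs : 2 ≤ s) : cut s = 0 :=
  Real.smoothTransition.zero_of_nonpos (by linarith)

/-- `0 ≤ χ s ≤ 1`. [folklore] -/
theorem cut_mem_Icc (s : ℝ) : cut s ∈ Icc (0 : ℝ) 1 :=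
  ⟨Real.smoothTransition.nonneg _, Real.smoothTransition.le_one _⟩

/-- `χ` is smooth. [folklore] -/
theorem contDiff_cut : ContDiff ℝ ∞ cut :=
  Real.smoothTransition.contDiff.comp (contDiff_const.sub contDiff_id)

/-- The inner cut-off `χ₀ s = smoothTransition (2 s / ρ₃ - 1)`: `0` for `s ≤ ρ₃ / 2`, `1` for
`s ≥ ρ₃`. [folklore] -/
def cut₀ (T : E ≃L[ℝ] E) (s : ℝ) : ℝ := Real.smoothTransition (2 * s / rho₃ T - 1)

/-- `χ₀ s = 1` for `ρ₃ ≤ s`. [folklore] -/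
theorem cut₀_of_rho₃_le (T : E ≃L[ℝ] E) {s : ℝ} (hs : rho₃ T ≤ s) : cut₀ T s = 1 := by
  apply Real.smoothTransition.one_of_one_le
  have h := rho₃_pos T
  rw [le_sub_iff_add_le, le_div_iff₀ h]
  linarith

/-- `χ₀ s = 0` for `s ≤ ρ₃ / 2`. [folklore] -/
theorem cut₀_of_le (T : E ≃L[ℝ] E) {s : ℝ} (hs : s ≤ rho₃ T / 2) : cut₀ T s = 0 := by
  apply Real.smoothTransition.zero_of_nonpos
  have h := rho₃_pos T
  rw [sub_nonpos, div_le_one h]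
  linarith

/-- `0 ≤ χ₀ s ≤ 1`. [folklore] -/
theorem cut₀_mem_Icc (T : E ≃L[ℝ] E) (s : ℝ) : cut₀ T s ∈ Icc (0 : ℝ) 1 :=
  ⟨Real.smoothTransition.nonneg _, Real.smoothTransition.le_one _⟩

/-- `χ₀` is smooth. [folklore] -/
theorem contDiff_cut₀ (T : E ≃L[ℝ] E) : ContDiff ℝ ∞ (cut₀ T) :=
  Real.smoothTransition.contDiff.comp
    (((contDiff_const.mul contDiff_id).div_const _).sub contDiff_const)

/-! ### The perturbation and the step map -/

/-- The coefficient `q v = c v · χ ‖v‖ · χ₀ ‖v‖ / ‖v‖` of the radial perturbation. [folklore] -/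
def pertCoeff (T : E ≃L[ℝ] E) (v : E) : ℝ := shift T v * cut ‖v‖ * cut₀ T ‖v‖ / ‖v‖

/-- The radial perturbation `q v • v`, supported in the shell `{ρ₃ / 2 ≤ ‖v‖ ≤ 2}`. [folklore] -/
def pert (T : E ≃L[ℝ] E) (v : E) : E := pertCoeff T v • v

/-- The step map `v ↦ v + κ • (q v • v)`. [folklore] -/
def stepFun (T : E ≃L[ℝ] E) (κ : ℝ) (v : E) : E := v + κ • pert T v

/-- The step map is radial: `stepFun v = (1 + κ q v) • v`. [folklore] -/
theorem stepFun_eq_smul (T : E ≃L[ℝ] E) (κ : ℝ) (v : E) :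
    stepFun T κ v = (1 + κ * pertCoeff T v) • v := by
  unfold stepFun pert; rw [add_smul, one_smul, smul_smul]

/-- `q 0 = 0`-behaviour: the perturbation vanishes at `0`. [folklore] -/
theorem pert_zero (T : E ≃L[ℝ] E) : pert T 0 = 0 := by simp [pert]

/-- The perturbation vanishes for `‖v‖ ≥ 2`. [folklore] -/
theorem pert_eq_zero_of_two_le (T : E ≃L[ℝ] E) {v : E} (hv : 2 ≤ ‖v‖) : pert T v = 0 := by
  simp [pert, pertCoeff, cut_of_two_le hv]

/-- The perturbation vanishes for `‖v‖ ≤ ρ₃ / 2`. [folklore] -/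
theorem pert_eq_zero_of_le (T : E ≃L[ℝ] E) {v : E} (hv : ‖v‖ ≤ rho₃ T / 2) : pert T v = 0 := by
  simp [pert, pertCoeff, cut₀_of_le T hv]

/-- Bound on the coefficient: `|q v| ≤ 2 / ρ₃` (when `T` does not decrease norms). [folklore] -/
theorem abs_pertCoeff_le {T : E ≃L[ℝ] E} (hT : ∀ v, ‖v‖ ≤ ‖T v‖) (v : E) :
    |pertCoeff T v| ≤ 2 / rho₃ T := by
  have hρ := rho₃_pos T
  unfold pertCoeff
  rcases le_or_gt ‖v‖ (rho₃ T / 2) with hv | hv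
  · rw [cut₀_of_le T hv]; simp; positivity
  · have hv0 : 0 < ‖v‖ := by linarith
    rw [abs_div, abs_of_pos hv0, div_le_div_iff₀ hv0 hρ, abs_mul, abs_mul]
    have h1 := abs_shift_le_one hT v
    have h2 : |cut ‖v‖| ≤ 1 := by
      rw [abs_of_nonneg (cut_mem_Icc _).1]; exact (cut_mem_Icc _).2
    have h3 : |cut₀ T ‖v‖| ≤ 1 := by
      rw [abs_of_nonneg (cut₀_mem_Icc T _).1]; exact (cut₀_mem_Icc T _).2
    calc |shift T v| * |cut ‖v‖| * |cut₀ T ‖v‖| * rho₃ T ≤ 1 * 1 * 1 * rho₃ T := by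
          gcongr
      _ = rho₃ T := by ring
      _ ≤ 2 * ‖v‖ := by linarith

/-- For `0 ≤ κ < ρ₃ / 2` the radial factor `1 + κ q v` is positive (indeed `> 0`). [folklore] -/
theorem one_add_mul_pertCoeff_pos {T : E ≃L[ℝ] E} (hT : ∀ v, ‖v‖ ≤ ‖T v‖) {κ : ℝ} (hκ : 0 ≤ κ)
    (hκ' : κ < rho₃ T / 2) (v : E) : 0 < 1 + κ * pertCoeff T v := by
  have hρ := rho₃_pos T
  have h1 := abs_pertCoeff_le hT v
  have h2 : |κ * pertCoeff T v| < 1 := by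
    rw [abs_mul, abs_of_nonneg hκ]
    calc κ * |pertCoeff T v| ≤ κ * (2 / rho₃ T) := by gcongr
      _ < rho₃ T / 2 * (2 / rho₃ T) := by gcongr
      _ = 1 := by field_simp
  have h3 := neg_abs_le (κ * pertCoeff T v)
  linarith

/-- **Norm of the step map**: `‖stepFun v‖ = ‖v‖ + κ · c v · χ ‖v‖ · χ₀ ‖v‖` for
`0 ≤ κ < ρ₃ / 2`. [folklore] -/
theorem norm_stepFun {T : E ≃L[ℝ] E} (hT : ∀ v, ‖v‖ ≤ ‖T v‖) {κ : ℝ} (hκ : 0 ≤ κ)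
    (hκ' : κ < rho₃ T / 2) (v : E) :
    ‖stepFun T κ v‖ = ‖v‖ + κ * (shift T v * cut ‖v‖ * cut₀ T ‖v‖) := by
  rw [stepFun_eq_smul, norm_smul, Real.norm_of_nonneg (one_add_mul_pertCoeff_pos hT hκ hκ' v).le]
  rcases eq_or_ne v 0 with rfl | hv
  · have h0 : cut₀ T 0 = 0 := cut₀_of_le T (by have := rho₃_pos T; positivity)
    simp [h0]
  · have hv0 : ‖v‖ ≠ 0 := norm_ne_zero_iff.2 hv
    unfold pertCoeff
    rw [add_mul, one_mul, mul_assoc κ, div_mul_cancel₀ _ hv0]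

/-- The step map does not increase norms (`c ≤ 0`). [folklore] -/
theorem norm_stepFun_le {T : E ≃L[ℝ] E} (hT : ∀ v, ‖v‖ ≤ ‖T v‖) {κ : ℝ} (hκ : 0 ≤ κ)
    (hκ' : κ < rho₃ T / 2) (v : E) : ‖stepFun T κ v‖ ≤ ‖v‖ := by
  rw [norm_stepFun hT hκ hκ' v]
  have h1 : shift T v * cut ‖v‖ * cut₀ T ‖v‖ ≤ 0 := by
    have := shift_nonpos hT v
    have := (cut_mem_Icc ‖v‖).1
    have := (cut₀_mem_Icc T ‖v‖).1
    exact mul_nonpos_of_nonpos_of_nonneg (mul_nonpos_of_nonpos_of_nonneg ‹_› ‹_›) ‹_›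
  nlinarith

/-- The step map decreases norms by at most `κ |c v|`: `‖v‖ + κ c v ≤ ‖stepFun v‖`. [folklore] -/
theorem norm_add_le_norm_stepFun {T : E ≃L[ℝ] E} (hT : ∀ v, ‖v‖ ≤ ‖T v‖) {κ : ℝ} (hκ : 0 ≤ κ)
    (hκ' : κ < rho₃ T / 2) (v : E) : ‖v‖ + κ * shift T v ≤ ‖stepFun T κ v‖ := by
  rw [norm_stepFun hT hκ hκ' v]
  have hs := shift_nonpos hT v
  have hc := cut_mem_Icc ‖v‖
  have hc₀ := cut₀_mem_Icc T ‖v‖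
  have h1 : shift T v ≤ shift T v * cut ‖v‖ * cut₀ T ‖v‖ := by
    have h2 : cut ‖v‖ * cut₀ T ‖v‖ ≤ 1 := by nlinarith [hc.1, hc.2, hc₀.1, hc₀.2]
    have h3 : 0 ≤ cut ‖v‖ * cut₀ T ‖v‖ := mul_nonneg hc.1 hc₀.1
    nlinarith
  nlinarith

/-- On the shell `ρ₃ ≤ ‖v‖ ≤ 1` both cut-offs are `1` and the step map is the radial shift by
`κ c v`: `stepFun v = ((‖v‖ + κ c v) / ‖v‖) • v`. [folklore] -/
theorem stepFun_of_mem_shell (T : E ≃L[ℝ] E) (κ : ℝ) {v : E} (h₁ : rho₃ T ≤ ‖v‖) (h₂ : ‖v‖ ≤ 1) :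
    stepFun T κ v = ((‖v‖ + κ * shift T v) / ‖v‖) • v := by
  rw [stepFun_eq_smul]
  have hv0 : ‖v‖ ≠ 0 := by have := rho₃_pos T; exact (lt_of_lt_of_le this h₁).ne'
  unfold pertCoeff
  rw [cut_of_le_one h₂, cut₀_of_rho₃_le T h₁]
  congr 1
  field_simp

/-- The step map is the identity for `‖v‖ ≥ 2`. [folklore] -/
theorem stepFun_of_two_le (T : E ≃L[ℝ] E) (κ : ℝ) {v : E} (hv : 2 ≤ ‖v‖) : stepFun T κ v = v := by
  simp [stepFun, pert_eq_zero_of_two_le T hv]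

/-- The step map fixes `0`. [folklore] -/
theorem stepFun_zero (T : E ≃L[ℝ] E) (κ : ℝ) : stepFun T κ 0 = 0 := by simp [stepFun, pert_zero]

/-! ### Smoothness and compact support of the perturbation -/

/-- The shift `c` is smooth away from `0` if the norm is. [folklore] -/
theorem contDiffOn_shift (hN : ContDiffOn ℝ ∞ (fun v : E => ‖v‖) {0}ᶜ) (T : E ≃L[ℝ] E) :
    ContDiffOn ℝ ∞ (shift T) {0}ᶜ := by
  have h1 : ContDiffOn ℝ ∞ (fun v : E => ‖T v‖) {0}ᶜ :=
    hN.comp (T : E →L[ℝ] E).contDiff.contDiffOn fun v hv => by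
      simpa using hv
  refine (hN.div h1 fun v hv => ?_).sub contDiffOn_const
  exact norm_ne_zero_iff.2 (by simpa using hv)

/-- The perturbation is smooth away from `0` if the norm is. [folklore] -/
theorem contDiffOn_pert (hN : ContDiffOn ℝ ∞ (fun v : E => ‖v‖) {0}ᶜ) (T : E ≃L[ℝ] E) :
    ContDiffOn ℝ ∞ (pert T) {0}ᶜ := by
  have hq : ContDiffOn ℝ ∞ (pertCoeff T) {0}ᶜ := by
    refine (((contDiffOn_shift hN T).mul (contDiff_cut.comp_contDiffOn hN)).mul
      ((contDiff_cut₀ T).comp_contDiffOn hN)).div hN fun v hv => ?_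
    exact norm_ne_zero_iff.2 hv
  exact hq.smul contDiffOn_id

/-- **The perturbation is smooth on all of `E`** (it vanishes near `0`). [folklore] -/
theorem contDiff_pert (hN : ContDiffOn ℝ ∞ (fun v : E => ‖v‖) {0}ᶜ) (T : E ≃L[ℝ] E) :
    ContDiff ℝ ∞ (pert T) := by
  rw [contDiff_iff_contDiffAt]
  intro v
  rcases eq_or_ne v 0 with rfl | hv
  · have hev : pert T =ᶠ[𝓝 (0 : E)] fun _ => 0 := by
      have hρ := rho₃_pos T
      filter_upwards [Metric.ball_mem_nhds (0 : E) (half_pos hρ)] with w hw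
      rw [mem_ball, dist_zero_right] at hw
      exact pert_eq_zero_of_le T hw.le
    exact contDiffAt_const.congr_of_eventuallyEq hev
  · exact (contDiffOn_pert hN T).contDiffAt (isOpen_compl_singleton.mem_nhds hv)

/-- The perturbation has compact support (it vanishes off `B̄(0, 2)`; finite dimension).
[folklore] -/
theorem hasCompactSupport_pert [FiniteDimensional ℝ E] (T : E ≃L[ℝ] E) :
    HasCompactSupport (pert T) := by
  refine HasCompactSupport.intro (isCompact_closedBall (0 : E) 2) fun v hv => ?_
  rw [mem_closedBall, dist_zero_right, not_le] at hv
  exact pert_eq_zero_of_two_le T hv.le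

/-- The step map is smooth. [folklore] -/
theorem contDiff_stepFun (hN : ContDiffOn ℝ ∞ (fun v : E => ‖v‖) {0}ᶜ) (T : E ≃L[ℝ] E) (κ : ℝ) :
    ContDiff ℝ ∞ (stepFun T κ) :=
  contDiff_id.add (contDiff_const.smul (contDiff_pert hN T))

/-- The derivative of the step map is `id + κ • D(pert)`. [folklore] -/
theorem fderiv_stepFun (hN : ContDiffOn ℝ ∞ (fun v : E => ‖v‖) {0}ᶜ) (T : E ≃L[ℝ] E) (κ : ℝ)
    (v : E) : fderiv ℝ (stepFun T κ) v =
      ContinuousLinearMap.id ℝ E + κ • fderiv ℝ (pert T) v := by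
  have hd : DifferentiableAt ℝ (pert T) v := (contDiff_pert hN T).differentiable (by simp) v
  exact ((hasFDerivAt_id v).add (hd.hasFDerivAt.const_smul κ)).fderiv

/-! ### Trajectories of the iterated step map -/

section Iterate

variable {T : E ≃L[ℝ] E} (hT : ∀ v, ‖v‖ ≤ ‖T v‖) {κ : ℝ} (hκ : 0 ≤ κ) (hκ' : κ < rho₃ T / 2)
include hT hκ hκ'

/-- The iterates of the step map are radial with positive factor. [folklore] -/
theorem iterate_radial (j : ℕ) (v : E) : ∃ μ : ℝ, 0 < μ ∧ (stepFun T κ)^[j] v = μ • v := by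
  induction j with
  | zero => exact ⟨1, one_pos, by simp⟩
  | succ j ih =>
    obtain ⟨μ, hμ, h⟩ := ih
    refine ⟨(1 + κ * pertCoeff T (μ • v)) * μ,
      mul_pos (one_add_mul_pertCoeff_pos hT hκ hκ' _) hμ, ?_⟩
    rw [iterate_succ_apply', h, stepFun_eq_smul, smul_smul]

omit hκ' in
/-- **Shell trajectories**: for `ρ₂ < ‖v‖ ≤ 1` and `j κ ≤ 1`, the `j`-th iterate is the radial
shift by `j κ c v` (the cut-offs are `≡ 1` along the trajectory). [folklore] -/
theorem iterate_shell {v : E} (h₁ : rho₂ T < ‖v‖) (h₂ : ‖v‖ ≤ 1) (j : ℕ) (hj : (j : ℝ) * κ ≤ 1) :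
    (stepFun T κ)^[j] v = ((‖v‖ + j * κ * shift T v) / ‖v‖) • v := by
  have hv : v ≠ 0 := by
    rintro rfl; have := rho₂_pos T; simp at h₁; linarith
  have hs : 0 < ‖v‖ := norm_pos_iff.2 hv
  have hc := shift_nonpos hT v
  have hρ := rho₃_le_rho₂_add_shift T hv
  induction j with
  | zero => simp [hs.ne']
  | succ j ih =>
    have hj' : (j : ℝ) * κ ≤ 1 := by
      have : (j : ℝ) * κ ≤ (j + 1 : ℕ) * κ := by push_cast; nlinarith
      exact this.trans hj
    rw [iterate_succ_apply', ih hj']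
    -- the intermediate point `w`
    set r : ℝ := ‖v‖ + j * κ * shift T v with hr
    have hr₁ : rho₃ T ≤ r := by
      have : ‖v‖ + shift T v ≤ r := by rw [hr]; nlinarith
      linarith
    have hr₀ : 0 < r := (rho₃_pos T).trans_le hr₁
    have hr₂ : r ≤ ‖v‖ := by
      have : (j : ℝ) * κ * shift T v ≤ 0 := mul_nonpos_of_nonneg_of_nonpos (by positivity) hc
      rw [hr]; linarith
    have hfac : 0 < r / ‖v‖ := div_pos hr₀ hs
    have hnw : ‖(r / ‖v‖) • v‖ = r := by
      rw [norm_smul, Real.norm_of_nonneg hfac.le, div_mul_cancel₀ _ hs.ne']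
    rw [stepFun_of_mem_shell T κ (by rw [hnw]; exact hr₁) (by rw [hnw]; exact hr₂.trans h₂), hnw,
      shift_smul T hfac.ne', smul_smul]
    congr 1
    push_cast
    field_simp
    ring

/-- **Small-ball trajectories**: for `0 < ‖v‖ ≤ ρ₂` and `j κ ≤ 1`, the `j`-th iterate either has
norm `≤ ρ₃` or has norm exactly `‖v‖ + j κ c v`. [folklore] -/
theorem iterate_small {v : E} (h₂ : ‖v‖ ≤ rho₂ T) (j : ℕ) (hj : (j : ℝ) * κ ≤ 1) :
    ‖(stepFun T κ)^[j] v‖ ≤ rho₃ T ∨ ‖(stepFun T κ)^[j] v‖ = ‖v‖ + j * κ * shift T v := by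
  have hc := shift_nonpos hT v
  induction j with
  | zero => right; simp
  | succ j ih =>
    have hj' : (j : ℝ) * κ ≤ 1 := by
      have : (j : ℝ) * κ ≤ (j + 1 : ℕ) * κ := by push_cast; nlinarith
      exact this.trans hj
    obtain ⟨μ, hμ, hw⟩ := iterate_radial hT hκ hκ' j v
    rw [iterate_succ_apply']
    set w := (stepFun T κ)^[j] v with hw_def
    have hshift : shift T w = shift T v := by rw [hw, shift_smul T hμ.ne']
    rcases le_or_gt ‖w‖ (rho₃ T) with hwρ | hwρ
    · left; exact (norm_stepFun_le hT hκ hκ' w).trans hwρ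
    · rcases ih hj' with h | h
      · exact absurd h (not_le.2 hwρ)
      · right
        have hw1 : ‖w‖ ≤ 1 := by
          have : (j : ℝ) * κ * shift T v ≤ 0 := mul_nonpos_of_nonneg_of_nonpos (by positivity) hc
          have : ‖w‖ ≤ ‖v‖ := by rw [h]; linarith
          exact this.trans (h₂.trans (rho₂_lt_one T).le)
        rw [norm_stepFun hT hκ hκ' w, cut_of_le_one hw1, cut₀_of_rho₃_le T hwρ.le, hshift, h]
        push_cast; ring

/-- **Exterior trajectories**: for `1 < ‖v‖` and `j κ ≤ 1`, the `j`-th iterate has norm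
`> 1 + j κ c v` (comparison with the exact trajectory started on the unit sphere: each step
decreases the norm by at most `κ |c v|`). [folklore] -/
theorem iterate_outer {v : E} (h₁ : 1 < ‖v‖) (j : ℕ) :
    1 + j * κ * shift T v < ‖(stepFun T κ)^[j] v‖ := by
  induction j with
  | zero => simpa using h₁
  | succ j ih =>
    have hv : v ≠ 0 := by rintro rfl; simp at h₁; linarith
    obtain ⟨μ, hμ, hw⟩ := iterate_radial hT hκ hκ' j v
    rw [iterate_succ_apply']
    set w := (stepFun T κ)^[j] v with hw_def
    have hshift : shift T w = shift T v := by rw [hw, shift_smul T hμ.ne']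
    have h2 := norm_add_le_norm_stepFun hT hκ hκ' w
    rw [hshift] at h2
    push_cast
    linarith

end Iterate

/-! ### The radial diffeomorphism -/

/-- **The radial interpolation diffeomorphism.** Let the norm of the finite-dimensional space
`E` be smooth away from `0` and let `T` be a linear automorphism with `‖v‖ ≤ ‖T v‖`. There is a
diffeomorphism `β` of `E` with: `β 0 = 0`; `β = id` off `B(0, 2)`; on the shell
`ρ₂ < ‖v‖ ≤ 1`, `β` is the radial shift `v ↦ ((‖v‖ + c v) / ‖v‖) v` by `c v = ‖v‖ / ‖T v‖ - 1`
(i.e. `β ∘ σ = σ_T` there, `σ`, `σ_T` the inversions of the unit disc and of the `T`-unit disc);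
`β` is radial with positive factor; `β` maps the punctured ball `B̄(0, ρ₂) ∖ 0` into the
punctured `T`-unit disc `{0 < ‖T ·‖ < 1}`; and `‖β v‖ > 1 + c v` for `‖v‖ > 1`.
Construction: `K`-fold iterate of a `K⁻¹`-small smooth compactly supported radial perturbation
of the identity, a diffeomorphism by `Diffeomorph.ofNormFDerivSubIdLe`. [folklore] -/
theorem exists_shapeDiffeo [FiniteDimensional ℝ E] (hN : ContDiffOn ℝ ∞ (fun v : E => ‖v‖) {0}ᶜ)
    (T : E ≃L[ℝ] E) (hT : ∀ v, ‖v‖ ≤ ‖T v‖) :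
    ∃ β : E ≃ₘ⟮𝓘(ℝ, E), 𝓘(ℝ, E)⟯ E,
      β 0 = 0 ∧ (∀ v, 2 ≤ ‖v‖ → β v = v) ∧
      (∀ v, rho₂ T < ‖v‖ → ‖v‖ ≤ 1 → β v = ((‖v‖ + shift T v) / ‖v‖) • v) ∧
      (∀ v, ∃ μ : ℝ, 0 < μ ∧ β v = μ • v) ∧
      (∀ v, v ≠ 0 → ‖v‖ ≤ rho₂ T → 0 < ‖T (β v)‖ ∧ ‖T (β v)‖ < 1) ∧
      (∀ v, 1 < ‖v‖ → 1 + shift T v < ‖β v‖) := by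
  -- derivative bound for the perturbation
  have hpert := contDiff_pert hN T
  have hcont : Continuous (fderiv ℝ (pert T)) := hpert.continuous_fderiv (by simp)
  obtain ⟨C, hC⟩ := hcont.bounded_above_of_compact_support
    ((hasCompactSupport_pert T).fderiv (𝕜 := ℝ))
  have hC0 : 0 ≤ C := (norm_nonneg _).trans (hC 0)
  -- the number of steps
  set K : ℕ := ⌈2 * C⌉₊ + ⌈2 / rho₃ T⌉₊ + 1 with hK
  have hρ := rho₃_pos T
  have hK0 : (0 : ℝ) < K := by rw [hK]; positivity
  have hKC : 2 * C ≤ K := by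
    rw [hK]; push_cast
    have := Nat.le_ceil (2 * C); have := Nat.le_ceil (2 / rho₃ T)
    have : (0 : ℝ) ≤ ⌈2 / rho₃ T⌉₊ := by positivity
    linarith
  have hKρ : 2 / rho₃ T < K := by
    rw [hK]; push_cast
    have := Nat.le_ceil (2 * C); have := Nat.le_ceil (2 / rho₃ T)
    have : (0 : ℝ) ≤ ⌈2 * C⌉₊ := by positivity
    linarith
  set κ : ℝ := 1 / K with hκ_def
  have hκ : 0 ≤ κ := by positivity
  have hκpos : 0 < κ := by positivity
  have hκ' : κ < rho₃ T / 2 := by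
    rw [hκ_def, div_lt_div_iff₀ hK0 two_pos, one_mul]
    rw [div_lt_iff₀ hρ] at hKρ
    linarith
  have hKκ : (K : ℝ) * κ = 1 := by rw [hκ_def]; field_simp
  -- the step diffeomorphism
  have hbound : ∀ x, ‖fderiv ℝ (stepFun T κ) x - ContinuousLinearMap.id ℝ E‖ ≤ 1 / 2 := by
    intro x
    rw [fderiv_stepFun hN T κ x, add_sub_cancel_left, norm_smul, Real.norm_of_nonneg hκ]
    calc κ * ‖fderiv ℝ (pert T) x‖ ≤ κ * C := by gcongr; exact hC x
      _ = C / K := by rw [hκ_def]; ring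
      _ ≤ 1 / 2 := by
        rw [div_le_div_iff₀ hK0 two_pos]
        linarith
  set step : E ≃ₘ⟮𝓘(ℝ, E), 𝓘(ℝ, E)⟯ E :=
    Diffeomorph.ofNormFDerivSubIdLe (stepFun T κ) (contDiff_stepFun hN T κ) (by simp) hbound
    with hstep
  have hstep_coe : ⇑step = stepFun T κ := rfl
  -- its `K`-fold iterate
  let iterD : ℕ → E ≃ₘ⟮𝓘(ℝ, E), 𝓘(ℝ, E)⟯ E := fun j =>
    Nat.rec (Diffeomorph.refl _ _ _) (fun _ d => d.trans step) j
  have hiter : ∀ j, ⇑(iterD j) = (stepFun T κ)^[j] := by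
    intro j
    induction j with
    | zero => rfl
    | succ j ih =>
      show ⇑((iterD j).trans step) = (stepFun T κ)^[j + 1]
      rw [iterate_succ']
      ext v
      show step (iterD j v) = _
      rw [hstep_coe, ih]
      rfl
  have happ : ∀ v, iterD K v = (stepFun T κ)^[K] v := fun v => congrFun (hiter K) v
  refine ⟨iterD K, ?_, ?_, ?_, ?_, ?_, ?_⟩
  · exact (happ 0).trans (iterate_fixed (stepFun_zero T κ) K)
  · intro v hv; exact (happ v).trans (iterate_fixed (stepFun_of_two_le T κ hv) K)
  · intro v h₁ h₂
    rw [happ v, iterate_shell hT hκ h₁ h₂ K hKκ.le, hKκ, one_mul]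
  · intro v; rw [happ v]; exact iterate_radial hT hκ hκ' K v
  · intro v hv h₂
    rw [happ v]
    obtain ⟨μ, hμ, hβ⟩ := iterate_radial hT hκ hκ' K v
    have hs : 0 < ‖v‖ := norm_pos_iff.2 hv
    have hTv : 0 < ‖T v‖ := norm_pos_iff.2 (by simpa using hv)
    have hTβ : ‖T ((stepFun T κ)^[K] v)‖ = μ * ‖T v‖ := by
      rw [hβ, map_smul, norm_smul, Real.norm_of_nonneg hμ.le]
    refine ⟨by rw [hTβ]; positivity, ?_⟩
    rcases iterate_small hT hκ hκ' h₂ K hKκ.le with h | h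
    · -- the image has norm `≤ ρ₃`, and `Λ ρ₃ = 1/2`
      calc ‖T ((stepFun T κ)^[K] v)‖ ≤ lam T * ‖(stepFun T κ)^[K] v‖ := norm_apply_le_lam T _
        _ ≤ lam T * rho₃ T := by gcongr; exact (lam_pos T).le
        _ = 1 / 2 := lam_mul_rho₃ T
        _ < 1 := by norm_num
    · -- the image has norm exactly `‖v‖ + c v`
      rw [hKκ, one_mul] at h
      have hμ' : μ * ‖v‖ = ‖v‖ + shift T v := by
        rw [← h, hβ, norm_smul, Real.norm_of_nonneg hμ.le]
      rw [hTβ]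
      -- `μ ‖T v‖ = ‖T v‖ + 1 - ‖T v‖ / ‖v‖ = 1 - ‖T v‖ (1 - ‖v‖) / ‖v‖ < 1`
      have hsv : ‖v‖ < 1 := h₂.trans_lt (rho₂_lt_one T)
      have key : μ * ‖T v‖ = 1 - ‖T v‖ * (1 - ‖v‖) / ‖v‖ := by
        have hμv : μ = (‖v‖ + shift T v) / ‖v‖ := by
          rw [← hμ']; field_simp
        rw [hμv]
        unfold shift
        field_simp
        ring
      rw [key]
      have : 0 < ‖T v‖ * (1 - ‖v‖) / ‖v‖ := by
        apply div_pos _ hs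
        exact mul_pos hTv (by linarith)
      linarith
  · intro v h₁
    rw [happ v]
    have h := iterate_outer hT hκ hκ' h₁ K
    rwa [hKκ, one_mul] at h

end ShapeRadial

end Literature.Topology.FourManifolds
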